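import Literature.AnabelianGeometry.EtaleTheta.SettingModel
import Literature.AnabelianGeometry.EtaleTheta.SettingModelAbelianShadow
import Literature.AnabelianGeometry.EtaleTheta.Discharge.Sec1Thm16GKNTate
import HarnessLib

/-!
# The Tate-module clause `tate2` of `ThetaSetting.IsThm16Origin` HOLDS at the root NV model
# `ThetaSetting.model p` — hence so does «G_{K_2} = Ker(G_K ↷ (Δ^tp_X)^ell / 2·(Δ^tp_Y)^ell)» there

Mochizuki, *The étale theta function …*, Publ. RIMS **45** (2009) [EtTh], §1 p. 13 ("`(Δ^tp_Y)^ell` [≅ `Ẑ(1)`]",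
"`G_{K_N}` acts trivially on `(Δ^tp_X)^ell/N·(Δ^tp_Y)^ell`") [cite: MochizukiEtTh2009, §1 p.13]. Layer L2
of the abc-iut cell; seat abc-iut-w5-d051 (SUBDAG-EtTh-Thm16 leaf L04 lineage). KERNEL NON-VACUITY of
the clause `tate` AT `N = 2` (drafted by this seat for abc-iut-L2-t6's origin predicate
`ThetaSetting.IsThm16Origin`, consumed by `Thm16Sub.gknIsKernelOfAction_of_tate`, p420414) at
abc-iut-L2-t1's explicit inhabitant `ThetaSetting.model p` (`Π^tp_X = F₂ × G_{ℚ_p}`, `q_X = p²`,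
`SettingModel.lean`): with `y₁ := (b, 1)`, `z := (a, 1)`, `ζ := −1`, `r := p`,

* (a) `(Δ^tp_Y)^ell / 2·(Δ^tp_Y)^ell = ℤ/2`, generated by `y₁` (the `b`-exponent parity; class-1 shadow
  `SettingModel.mem_KEll_iff_of_snd_eq_one`, `SettingModelAbelianShadow.lean`);
* (b) `aug(g)(−1) = (−1)^k` forces `k` odd, and conjugation by `g = (f, σ)` does not change exponent
  sums, so `(g y g⁻¹)^ell·(y^ell)^{−k} = ((y^ell)^{(k−1)/2})^{−2} ∈ 2·(Δ^tp_Y)^ell`;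
* (c) `aug(g)(p) = p = (−1)^m·p` forces `m` even, and `[g, z]^ell = 1`.

Hence **`SettingModel.model_tate2`** (the clause, verbatim at `N = 2`) and
**`SettingModel.model_gknIsKernelOfAction_two : Thm16Sub.GKNIsKernelOfAction (ThetaSetting.model p) 2`**.
(For `N ≥ 3` with `μ_N ⊄ ℚ_p` the clause — and the characterisation — FAIL at this degenerate model,
whose Galois factor acts trivially on `Δ`; Thm. 1.6 (i) consumes `N = 2` only.) HONEST LIMITS: consistency
evidence for a hypothesis bundle, not a statement about a curve; nothing of [EtTh] is asserted; no side is
taken on [IUTchIII] Cor. 3.12. Proof-only, no definitions.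
-/

noncomputable section

namespace Literature.AnabelianGeometry.EtaleTheta.SettingModel

open Literature.AnabelianGeometry.SemiGraphs Thm16Sub
open scoped commutatorElement

variable (p : ℕ) [Fact p.Prime]

/-! ### `(Π^tp_X)^ell = Π^tp_X / KEll` in coordinates (PiTp-level) -/

/-- Two elements of `Π^tp_X` with trivial Galois components and equal exponent sums have the same class
modulo `KEll`. [cite: MochizukiEtTh2009, §1 p.12] -/
theorem mk_KEll_eq_of_exponents {g h : PiTp p} (hg : g.2 = 1) (hh : h.2 = 1)
    (hx : (heisHom (Del.val g.1)).x = (heisHom (Del.val h.1)).x)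
    (hy : (heisHom (Del.val g.1)).y = (heisHom (Del.val h.1)).y) :
    QuotientGroup.mk' (KEll p) g = QuotientGroup.mk' (KEll p) h := by
  rw [QuotientGroup.mk'_apply, QuotientGroup.mk'_apply, QuotientGroup.eq]
  refine (mem_KEll_iff_of_snd_eq_one p (g := g⁻¹ * h) ?_).mpr ⟨?_, ?_⟩
  · change g.2⁻¹ * h.2 = 1
    rw [hg, hh, inv_one, one_mul]
  · change (heisHom (Del.val (g.1⁻¹ * h.1))).x = 0
    rw [map_mul, map_inv, map_mul, map_inv, Heis.mul_x, Heis.inv_x, hx, neg_add_cancel]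
  · change (heisHom (Del.val (g.1⁻¹ * h.1))).y = 0
    rw [map_mul, map_inv, map_mul, map_inv, Heis.mul_y, Heis.inv_y, hy, neg_add_cancel]

/-- Conjugation does not change the class modulo `KEll` of an element with trivial Galois component.
[cite: MochizukiEtTh2009, §1 p.12] -/
theorem mk_KEll_conj {y : PiTp p} (hy : y.2 = 1) (g : PiTp p) :
    QuotientGroup.mk' (KEll p) (g * y * g⁻¹) = QuotientGroup.mk' (KEll p) y := by
  refine mk_KEll_eq_of_exponents p ?_ hy ?_ ?_
  · change g.2 * y.2 * g.2⁻¹ = 1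
    rw [hy, mul_one, mul_inv_cancel]
  · change (heisHom (Del.val (g.1 * y.1 * g.1⁻¹))).x = _
    simp only [map_mul, map_inv, Heis.mul_x, Heis.inv_x]; ring
  · change (heisHom (Del.val (g.1 * y.1 * g.1⁻¹))).y = _
    simp only [map_mul, map_inv, Heis.mul_y, Heis.inv_y]; ring

/-- Commutators `[g, z]` with `z.2 = 1` die modulo `KEll`. [cite: MochizukiEtTh2009, §1 p.12] -/
theorem mk_KEll_commutator_eq_one {z : PiTp p} (hz : z.2 = 1) (g : PiTp p) :
    QuotientGroup.mk' (KEll p) (g * z * g⁻¹ * z⁻¹) = 1 := by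
  rw [map_mul (QuotientGroup.mk' (KEll p)) (g * z * g⁻¹) z⁻¹, mk_KEll_conj p hz g, map_inv,
    mul_inv_cancel]

/-! ### The model's ell-quotient and `2·(Δ^tp_Y)^ell` -/

/-- The model's ell-quotient map is the quotient by `KEll`. [cite: MochizukiEtTh2009, §1 p.12] -/
theorem toEll_model_apply (g : PiTp p) :
    toEll (ThetaSetting.model p) g = QuotientGroup.mk' (KEll p) g :=
  DFunLike.congr_fun (thetaToEllM_comp p) g

/-- Membership in `Δ^tp_Y` of the model: trivial Galois component and `a`-exponent sum `0`.
[cite: MochizukiEtTh2009, §1 p.12] -/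
theorem mem_DtpY_model_iff (g : PiTp p) :
    g ∈ (ThetaSetting.model p).DtpY ↔ (heisHom (Del.val g.1)).x = 0 ∧ g.2 = 1 := by
  change g ∈ (toZM p).ker ⊓ (curve p).DeltaTemp ↔ _
  rw [Subgroup.mem_inf, MonoidHom.mem_ker, toZM_apply, mem_deltaTemp_iff, ofAdd_eq_one]

/-- Even powers of the image of an element of `Δ^tp_Y` lie in `2·(Δ^tp_Y)^ell`. [cite: MochizukiEtTh2009, §1 p.13] -/
theorem zpow_two_mul_mem_ellPowersY_model {y : (ThetaSetting.model p).PiTemp}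
    (hy : y ∈ (ThetaSetting.model p).DtpY) (j : ℤ) :
    toEll (ThetaSetting.model p) y ^ (2 * j) ∈ ellPowersY (ThetaSetting.model p) 2 := by
  rw [mul_comm, zpow_mul]
  refine Subgroup.subset_closure ⟨toEll (ThetaSetting.model p) y ^ j,
    ⟨y ^ j, Subgroup.zpow_mem _ hy j, by rw [map_zpow]⟩, ?_⟩
  change (toEll (ThetaSetting.model p) y ^ j) ^ ((2 : ℕ+) : ℕ) = _
  rw [PNat.val_ofNat, zpow_ofNat]

/-- The `b`-exponent parity character kills `2·(Δ^tp_Y)^ell` of the model: if `(y₁^ell)^k ∈ 2·(Δ^tp_Y)^ell`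
for an element `y₁` of `b`-exponent sum `1`, then `2 ∣ k`. [cite: MochizukiEtTh2009, §1 p.13] -/
theorem two_dvd_of_pow_mem_ellPowersY_model {y₁ : (ThetaSetting.model p).PiTemp}
    (hb : (heisHom (Del.val y₁.1)).y = 1) (k : ℕ)
    (hk : toEll (ThetaSetting.model p) y₁ ^ k ∈ ellPowersY (ThetaSetting.model p) 2) : 2 ∣ k := by
  let red : Multiplicative ℤ →* Multiplicative (ZMod 2) := (Int.castAddHom (ZMod 2)).toMultiplicative
  let χ : PiTp p →* Multiplicative (ZMod 2) :=
    ((red.comp (Heis.yHom.comp heisHom)).comp Del.val).comp (MonoidHom.fst Del (Gam p))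
  have hχ : ∀ g : PiTp p, χ g = Multiplicative.ofAdd (((heisHom (Del.val g.1)).y : ℤ) : ZMod 2) :=
    fun g => rfl
  have hker : KEll p ≤ χ.ker := by
    intro g hg
    rw [MonoidHom.mem_ker, hχ, (exponents_eq_zero_and_snd_eq_one_of_mem_KEll p hg).2.1, Int.cast_zero,
      ofAdd_zero]
  let χM : (ThetaSetting.model p).GtpEll →* Multiplicative (ZMod 2) := QuotientGroup.lift (KEll p) χ hker
  have hχM : ∀ g : (ThetaSetting.model p).PiTemp, χM (toEll (ThetaSetting.model p) g) = χ g := by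
    intro g; rw [toEll_model_apply]; rfl
  have hkill : ellPowersY (ThetaSetting.model p) 2 ≤ χM.ker := by
    rw [ellPowersY, Subgroup.closure_le]
    rintro _ ⟨t, ⟨y, -, rfl⟩, rfl⟩
    rw [SetLike.mem_coe, MonoidHom.mem_ker]
    change χM (toEll (ThetaSetting.model p) y ^ ((2 : ℕ+) : ℕ)) = 1
    rw [map_pow, hχM, hχ, PNat.val_ofNat, ← ofAdd_nsmul, ofAdd_eq_one, nsmul_eq_mul, Nat.cast_ofNat,
      show (2 : ZMod 2) = 0 from rfl, zero_mul]
  have h1 := hkill hk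
  rw [MonoidHom.mem_ker, map_pow, hχM, hχ, hb, Int.cast_one, ← ofAdd_nsmul, nsmul_eq_mul, mul_one,
    ofAdd_eq_one, ZMod.natCast_eq_zero_iff] at h1
  exact h1

/-! ### Arithmetic of the model's base field -/

/-- `−1 ≠ 1` in `ℚ̄_p` (characteristic `0`). [folklore] -/
private theorem neg_one_ne_one' : (-1 : PadicAlgCl p) ≠ 1 := by
  intro h
  have h2 : (2 : PadicAlgCl p) = 0 := by
    calc (2 : PadicAlgCl p) = 1 - (-1) := by norm_num
      _ = 0 := by rw [h, sub_self]
  exact two_ne_zero h2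

/-- `(−1)^k = −1` in `ℚ̄_p` forces `k` odd. [folklore] -/
private theorem odd_of_neg_one_pow_eq {k : ℕ} (h : (-1 : PadicAlgCl p) ^ k = -1) : Odd k := by
  rcases Nat.even_or_odd k with hk | hk
  · rw [hk.neg_one_pow] at h
    exact absurd h.symm (neg_one_ne_one' p)
  · exact hk

/-- `(−1)^m = 1` in `ℚ̄_p` forces `m` even. [folklore] -/
private theorem even_of_neg_one_pow_eq_one {m : ℕ} (h : (-1 : PadicAlgCl p) ^ m = 1) : Even m := by
  rcases Nat.even_or_odd m with hm | hm
  · exact hm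
  · rw [hm.neg_one_pow] at h
    exact absurd h (neg_one_ne_one' p)

/-! ### The clause at `N = 2` -/

/-- **The clause `tate` at `N = 2` HOLDS at the root NV model** (with `y₁ = (b,1)`, `z = (a,1)`, `ζ = −1`,
`r = p`). [cite: MochizukiEtTh2009, §1 p.13] -/
theorem model_tate2 :
    ∃ (y₁ z : (ThetaSetting.model p).PiTemp) (ζ r : PadicAlgCl p),
      y₁ ∈ (ThetaSetting.model p).DtpY ∧ z ∈ (ThetaSetting.model p).DeltaTemp ∧
      (ThetaSetting.model p).toZ z = Multiplicative.ofAdd 1 ∧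
      IsPrimitiveRoot ζ ((2 : ℕ+) : ℕ) ∧ r ^ ((2 : ℕ+) : ℕ) = (ThetaSetting.model p).qX ∧
      (∀ y : (ThetaSetting.model p).PiTemp, y ∈ (ThetaSetting.model p).DtpY → ∃ k : ℕ,
        toEll (ThetaSetting.model p) y * (toEll (ThetaSetting.model p) y₁ ^ k)⁻¹ ∈
          ellPowersY (ThetaSetting.model p) 2) ∧
      (∀ k : ℕ, toEll (ThetaSetting.model p) y₁ ^ k ∈ ellPowersY (ThetaSetting.model p) 2 ↔
        ((2 : ℕ+) : ℕ) ∣ k) ∧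
      (∀ (g : (ThetaSetting.model p).PiTemp) (k : ℕ), (ThetaSetting.model p).aug g ζ = ζ ^ k →
        ∀ y : (ThetaSetting.model p).PiTemp, y ∈ (ThetaSetting.model p).DtpY →
          toEll (ThetaSetting.model p) (g * y * g⁻¹) * (toEll (ThetaSetting.model p) y ^ k)⁻¹ ∈
            ellPowersY (ThetaSetting.model p) 2) ∧
      (∀ (g : (ThetaSetting.model p).PiTemp) (m : ℕ), (ThetaSetting.model p).aug g r = ζ ^ m * r →
        toEll (ThetaSetting.model p) (g * z * g⁻¹ * z⁻¹) * (toEll (ThetaSetting.model p) y₁ ^ m)⁻¹ ∈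
          ellPowersY (ThetaSetting.model p) 2) := by
  obtain ⟨db, hdb⟩ := Del.val_bijective.2 (FreeGroup.of 1)
  obtain ⟨da, hda⟩ := Del.val_bijective.2 (FreeGroup.of 0)
  let y₁ : (ThetaSetting.model p).PiTemp := (db, 1)
  let z : (ThetaSetting.model p).PiTemp := (da, 1)
  have hy₁x : (heisHom (Del.val y₁.1)).x = 0 := by change (heisHom (Del.val db)).x = 0; rw [hdb]; simp
  have hy₁y : (heisHom (Del.val y₁.1)).y = 1 := by change (heisHom (Del.val db)).y = 1; rw [hdb]; simp
  have hy₁ : y₁ ∈ (ThetaSetting.model p).DtpY := (mem_DtpY_model_iff p y₁).mpr ⟨hy₁x, rfl⟩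
  have hz : z ∈ (ThetaSetting.model p).DeltaTemp := (mem_deltaTemp_iff p z).mpr rfl
  have hzZ : (ThetaSetting.model p).toZ z = Multiplicative.ofAdd 1 := by
    change toZM p z = _
    rw [toZM_apply]; change Multiplicative.ofAdd (heisHom (Del.val da)).x = _; rw [hda]; simp
  have h2 : ((2 : ℕ+) : ℕ) = 2 := rfl
  have hp0 : ((p : ℕ) : PadicAlgCl p) ≠ 0 := Nat.cast_ne_zero.mpr (Fact.out : p.Prime).ne_zero
  refine ⟨y₁, z, -1, ((p : ℕ) : PadicAlgCl p), hy₁, hz, hzZ, ?_, ?_, ?_, ?_, ?_, ?_⟩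
  · rw [h2]; exact IsPrimitiveRoot.neg_one 0 (by decide)
  · rw [h2]; rfl
  · -- (a) generation: `y ≡ y₁^{n}` (`n` the `b`-exponent of `y`) modulo squares
    intro y hy
    obtain ⟨hyx, hy2⟩ := (mem_DtpY_model_iff p y).mp hy
    obtain ⟨n, hn⟩ : ∃ n : ℤ, (heisHom (Del.val y.1)).y = n := ⟨_, rfl⟩
    refine ⟨(n % 2).toNat, ?_⟩
    have hmod : (((n % 2).toNat : ℕ) : ℤ) = n % 2 := Int.toNat_of_nonneg (Int.emod_nonneg _ two_ne_zero)
    -- `y · y₁^{-(n % 2)}` and `y₁^{(n/2)·2}` have the same exponents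
    have heq : QuotientGroup.mk' (KEll p) (y * (y₁ ^ ((n % 2).toNat : ℤ))⁻¹) =
        QuotientGroup.mk' (KEll p) (y₁ ^ (2 * (n / 2))) := by
      have hxy₁ : (heisHom (Del.val y₁.1)).x * (heisHom (Del.val y₁.1)).y = 0 := by
        rw [hy₁x]; exact zero_mul _
      refine mk_KEll_eq_of_exponents p ?_ ?_ ?_ ?_
      · change y.2 * (y₁.2 ^ ((n % 2).toNat : ℤ))⁻¹ = 1
        rw [hy2, one_mul]; change ((1 : Gam p) ^ ((n % 2).toNat : ℤ))⁻¹ = 1; rw [one_zpow, inv_one]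
      · change (1 : Gam p) ^ (2 * (n / 2)) = 1; exact one_zpow _
      · change (heisHom (Del.val (y.1 * (y₁.1 ^ ((n % 2).toNat : ℤ))⁻¹))).x =
          (heisHom (Del.val (y₁.1 ^ (2 * (n / 2))))).x
        simp only [map_mul, map_inv, map_zpow, Heis.mul_x, Heis.inv_x, Heis.zpow_eq_of_mul_eq_zero _ hxy₁]
        simp [hyx, hy₁x]
      · change (heisHom (Del.val (y.1 * (y₁.1 ^ ((n % 2).toNat : ℤ))⁻¹))).y =
          (heisHom (Del.val (y₁.1 ^ (2 * (n / 2))))).y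
        simp only [map_mul, map_inv, map_zpow, Heis.mul_y, Heis.inv_y, Heis.zpow_eq_of_mul_eq_zero _ hxy₁,
          hy₁y, mul_one, hn, hmod]
        linarith [Int.mul_ediv_add_emod n 2]
    have heq' : toEll (ThetaSetting.model p) y * (toEll (ThetaSetting.model p) y₁ ^ (n % 2).toNat)⁻¹ =
        toEll (ThetaSetting.model p) y₁ ^ (2 * (n / 2)) := by
      rw [← zpow_natCast, ← map_zpow, ← map_inv, ← map_mul, ← map_zpow, toEll_model_apply,
        toEll_model_apply]
      exact heq
    rw [heq']
    exact zpow_two_mul_mem_ellPowersY_model p hy₁ (n / 2)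
  · -- (a) order exactly 2
    intro k
    rw [h2]
    constructor
    · exact two_dvd_of_pow_mem_ellPowersY_model p hy₁y k
    · rintro ⟨j, rfl⟩
      have := zpow_two_mul_mem_ellPowersY_model p hy₁ j
      rwa [← zpow_natCast, Nat.cast_mul, Nat.cast_ofNat]
  · -- (b) Tate twist: `k` is odd, conjugation is invisible modulo `KEll`
    intro g k hk y hy
    have hy2 : y.2 = 1 := ((mem_DtpY_model_iff p y).mp hy).2
    have hk' : (-1 : PadicAlgCl p) ^ k = -1 := by rw [← hk, map_neg, map_one]
    obtain ⟨j, rfl⟩ := odd_of_neg_one_pow_eq p hk'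
    have hc : toEll (ThetaSetting.model p) (g * y * g⁻¹) = toEll (ThetaSetting.model p) y := by
      rw [toEll_model_apply, toEll_model_apply]; exact mk_KEll_conj p hy2 g
    rw [hc, pow_succ, mul_inv_rev, mul_inv_cancel_left]
    have := zpow_two_mul_mem_ellPowersY_model p hy j
    rw [← zpow_natCast, Nat.cast_mul, Nat.cast_ofNat]
    exact Subgroup.inv_mem _ this
  · -- (c) Kummer class of `q_X = p²`: `m` is even, `[g,z]` dies modulo `KEll`
    intro g m hm
    have hm1 : (-1 : PadicAlgCl p) ^ m = 1 := by
      have h' : (-1 : PadicAlgCl p) ^ m * (p : ℕ) = 1 * (p : ℕ) := by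
        rw [one_mul, ← hm]; exact map_natCast _ p
      exact mul_right_cancel₀ hp0 h'
    obtain ⟨j, hj⟩ := even_of_neg_one_pow_eq_one p hm1
    have hc : toEll (ThetaSetting.model p) (g * z * g⁻¹ * z⁻¹) = 1 := by
      rw [toEll_model_apply]; exact mk_KEll_commutator_eq_one p (z := z) rfl g
    rw [hc, one_mul, hj, ← two_mul]
    have := zpow_two_mul_mem_ellPowersY_model p hy₁ j
    rw [← zpow_natCast, Nat.cast_mul, Nat.cast_ofNat]
    exact Subgroup.inv_mem _ this

/-- **«G_{K_2} = Ker(G_K ↷ (Δ^tp_X)^ell / 2·(Δ^tp_Y)^ell)» holds at the root NV model**: the `N = 2`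
instance of abc-iut-L6-d5's `Thm16Sub.GKNIsKernelOfAction` at `ThetaSetting.model p`, by
`gknIsKernelOfAction_of_tate` (p420414) from `model_tate2`. [cite: MochizukiEtTh2009, §1 p.13] -/
theorem model_gknIsKernelOfAction_two : GKNIsKernelOfAction (ThetaSetting.model p) 2 := by
  obtain ⟨y₁, z, ζ, r, hy₁, hz, hzZ, hζ, hr, -, hord, htw, hkum⟩ := model_tate2 p
  exact gknIsKernelOfAction_of_tate (ThetaSetting.model p) 2 hy₁ hz hzZ hζ hr hord htw hkum

end Literature.AnabelianGeometry.EtaleTheta.SettingModel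

end
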